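import Summits.QuantumFields.YangMills.Theorems.UnitScaleTiltProp7PlaqKSlowFastKnit
import Summits.QuantumFields.YangMills.Theorems.UnitScaleTiltProp7CovIterLambdaHLambdaBridge
import Summits.QuantumFields.YangMills.Theorems.UnitScaleTiltProp7PlaquetteCurlComparison
import Summits.QuantumFields.YangMills.Theorems.UnitScaleTiltProp7CovHodgeSplit
import Literature.MathematicalPhysics.QuantumFieldTheory.Balaban1983to89.T3PrintedRegularMinimiser
import HarnessLib

/-!
# Route `UnitScaleTilt`, crux K1 «MinimiserStabilityRegPr» (stmt-QuantumFields-19200), route-R E′ S3, R5 door ✓ `Prop7ZetaRowOfEngineRows` — ROW (B) KNIT: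
# THE CO-CLOSED PART's ENERGIES IN K-CURRENCY, `G_W(B) + CURL_HS(B) ≤ ζ_B·K_W(D) + θ_B·e·ℓ⁻²·M(D)`, FROM THE DISPLAYED ROW hKg-K ALONE
# (Weitzenböck ∘ `D*_WB = 0` ∘ curl-vs-plaquette ∘ the parallelogram `K_W(B) ≤ 2K_W(D) + 2K_W(D_Wφ₀)` ∘ hKg-K ∘ the Hodge Pythagoras `Σ‖B‖² ≤ N·M(D)`)

Cell `ym3-torus`, width seat `ym3-torus-px12` (gen 4); ★ym-ust-19200-p1 g16 2026-08-28 23:13:52Z «px12: ROW (B) KNIT GO» (R5 door ✓p677112, row (B) = «your hKg-K socket + bridges»).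
THEOREMS ONLY (0 `def`, 0 `sorry`); `--supports stmt-QuantumFields-19200 --as helper`, count-neutral.  YM₃ on T³ is a ladder rung (R3), not the Clay problem; nothing here claims the stub,
the crux, d = 4 or the mass gap; hKg-K stays DISPLAYED (numerically inhabited only: `C_g ≈ 0.1` at constrained critical points, NUMERICS-19200-S3-CURVED-g15 addendum 5).

THE CHAIN (DESIGN-S3-KFORM-ENGINE-g15 R0∕R1; the door's docstring for (B)).  On a co-closed covariant Hodge split `D = B + D_Wφ₀`, `D*_WB = 0`, at a background with `dist1(W(∂p)) ≤ a`:
(1) Weitzenböck ✓ `Prop7CovIterLambdaHLambdaBridge.sum_normSq_covGrad_le_curl_divB`: `G_W(B) ≤ CURL_HS(B) + DIV_HS(B) + 2daN·Σ‖B‖²`; (2) `DIV_HS(B) = 0`; (3) `CURL_HS(B) = CURL_HS(iB)` and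
✓ `Prop7PlaquetteCurlComparison.curlHS_le_plaqK`: `CURL_HS(iB) ≤ N(2K_W(B) + 32da²Σ‖B‖²)`; (4) ✓ `Prop7PlaqKSlowFastKnit.plaqK_sub_le`: `K_W(B) ≤ 2K_W(D) + 2K_W(D_Wφ₀)`; (5) hKg-K DISPLAYED:
`K_W(D_Wφ₀) ≤ C_g·K_W(D) + Θ`; (6) Hodge Pythagoras from co-closedness (✓ `Prop7CovHodgeSplit.sum_trace_conjTranspose_covD_mul`, ✓ `sum_normSq_add_eq`) with op ≤ HS ≤ N·op:
`Σ‖B‖² ≤ N·Σ‖D‖²`.  Sum: `G_W(B) + CURL_HS(B) ≤ 8N(1 + C_g)·K_W(D) + 8N·Θ + N²·d·a·(64a + 2)·Σ‖D‖²`.  At the door (`N = 2`, `d = 3`, `a = e·ℓ⁻² ≤ 1`, `Θ = θ_g·e·ℓ⁻²·M`):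
`ζ_B = 16(1 + C_g)`, `θ_B = 16θ_g + 792`.

WHAT IS PROVED (ns `…Theorems.Prop7CoclosedEnergiesOfHKgK`; §1–§3 any `P`, level `i`, `SU(N)`; §4 the T³ reading in the R5 door's letters).
* §1 `curl_I_smul` (`curl(i·B) = i·curl B`), `curlHS_I_smul_eq` (`CURL_HS(iB) = CURL_HS(B)`), `sum_divHS_eq_zero_of_coclosed`.
* §2 ★ `sum_norm_sq_le_of_coclosed_split` — the Hodge Pythagoras `Σ_b‖B b‖² ≤ N·Σ_b‖D b‖²` for ANY co-closed split `D = B + D_Wφ₀`.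
* §3 ★★ `coclosed_energies_le_of_hKgK` — the generic row: `G_W(B) + CURL_HS(B) ≤ 8N(1+C_g)·K_W(D) + 8N·Θ + N²·d·a·(64a+2)·Σ‖D‖²` from hKg-K `K_W(D_Wφ₀) ≤ C_g·K_W(D) + Θ`.
* §4 ★★★ `rowB_of_hKgK_T3` — row (B) of ✓ `Prop7ZetaRowOfEngineRows.zetaRow_of_engineRows` VERBATIM (its two left summands and its right side with `ζ_B := 16(1 + C_g)`, `θ_B := 16θ_g + 792`)
  from hKg-K displayed in the door's letters, for `W` with `dist1(W(∂p)) ≤ e·ℓ⁻²`, `0 ≤ e ≤ 1`; `dist1_plaqHol_le_of_mem_regFibrePr` supplies that clause from `W ∈ regFibrePr` ((6)(e)).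
HONEST SCOPE.  Bookkeeping over landed theorems; hKg-K is an INPUT (at the door: displayed at `IsCritR2 W`, (N2)); constants crude (`792`), `L`-free; no estimate of Bałaban's is asserted.

References: T. Bałaban, CMP 102 (1985) 277–309 [Balaban1985Variational] ((6) p.278, (135) p.298, (141)–(143) p.299); CMP 99 (1985) 389–434 [Balaban1985BackgroundPropagators]
((3.3)–(3.4) pp.390–391, (3.8)–(3.10) p.392, Thm 3.11 p.416); CMP 95 (1984) 17–40 [Balaban1984PropagatorsI] ((1.21) p.21).
-/

set_option autoImplicit false

noncomputable section

open scoped BigOperators Matrix.Norms.L2Operator Matrix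

namespace Summit.QuantumFields.YangMills.Theorems.Prop7CoclosedEnergiesOfHKgK

open Literature.MathematicalPhysics.QuantumFieldTheory.Balaban1983to89
open B9Eq39Adjoint (R R_smul covD divB curl)
open B9TorusCalculus (torusT)
open B10Eq27TorusAxialLog (unitsField toUField unitsField_mem_unitaryUnits)
open Summit.QuantumFields.YangMills.Theorems.Prop7PlaqKSlowFastKnit (plaqK_sub_le)
open Summit.QuantumFields.YangMills.Theorems.Prop7CovIterLambdaHLambdaBridge (sum_normSq_covGrad_le_curl_divB)
open Summit.QuantumFields.YangMills.Theorems.Prop7PlaquetteCurlComparison (curlHS_le_plaqK)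
open Summit.QuantumFields.YangMills.Theorems.Prop7CovHodgeSplit (sum_trace_conjTranspose_covD_mul sum_normSq_add_eq)
open Summit.QuantumFields.YangMills.Theorems.Prop7CovariantCoercivity (sum_norm_sq_le_mul_opNorm_sq)

variable {P : Params} {i : ℕ} {N : ℕ}

/-! ## §1 Letters: `curl` is `ℂ`-linear; the divergence form of a co-closed field vanishes -/

/-- `curl_W(i·B) = i·curl_W(B)` (the covariant curl (3.4) is `ℂ`-linear; `R(u)(cX) = c·R(u)X`). [cite: Balaban1985BackgroundPropagators, (3.4) p.391] -/
theorem curl_I_smul (W : GaugeField P i (Matrix.specialUnitaryGroup (Fin N) ℂ)) (B : PBond P i → Matrix (Fin N) (Fin N) ℂ) (μ ν : Fin P.d) (x : Site P i) :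
    curl (torusT P i) (fun κ z => unitsField (toUField W) ⟨z, κ⟩) (fun κ z => Complex.I • B ⟨z, κ⟩) μ ν x
      = Complex.I • curl (torusT P i) (fun κ z => unitsField (toUField W) ⟨z, κ⟩) (fun κ z => B ⟨z, κ⟩) μ ν x := by
  simp only [curl, covD, R_smul, smul_sub]

/-- `CURL_HS(iB) = CURL_HS(B)` (entrywise `|i·z| = |z|`). [folklore] -/
theorem curlHS_I_smul_eq (W : GaugeField P i (Matrix.specialUnitaryGroup (Fin N) ℂ)) (B : PBond P i → Matrix (Fin N) (Fin N) ℂ) :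
    (∑ x : Site P i, ∑ μ : Fin P.d, ∑ ν : Fin P.d,
        (if μ < ν then ∑ j : Fin N, ∑ k : Fin N,
          ‖(curl (torusT P i) (fun κ z => unitsField (toUField W) ⟨z, κ⟩) (fun κ z => Complex.I • B ⟨z, κ⟩) μ ν x) j k‖ ^ 2 else 0))
      = (∑ x : Site P i, ∑ μ : Fin P.d, ∑ ν : Fin P.d,
        (if μ < ν then ∑ j : Fin N, ∑ k : Fin N,
          ‖(curl (torusT P i) (fun κ z => unitsField (toUField W) ⟨z, κ⟩) (fun κ z => B ⟨z, κ⟩) μ ν x) j k‖ ^ 2 else 0)) := by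
  refine Finset.sum_congr rfl fun x _ => Finset.sum_congr rfl fun μ _ => Finset.sum_congr rfl fun ν _ => ?_
  split_ifs
  · refine Finset.sum_congr rfl fun j _ => Finset.sum_congr rfl fun k _ => ?_
    rw [curl_I_smul, Matrix.smul_apply, smul_eq_mul, norm_mul, Complex.norm_I, one_mul]
  · rfl

/-- The Hilbert–Schmidt divergence form of a co-closed field vanishes. [cite: Balaban1985BackgroundPropagators, (3.8) p.392] -/
theorem sum_divHS_eq_zero_of_coclosed (W : GaugeField P i (Matrix.specialUnitaryGroup (Fin N) ℂ)) (B : PBond P i → Matrix (Fin N) (Fin N) ℂ)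
    (hBc : ∀ x : Site P i, divB (torusT P i) (fun κ z => unitsField (toUField W) ⟨z, κ⟩) (fun κ z => B ⟨z, κ⟩) x = 0) :
    (∑ x : Site P i, ∑ j : Fin N, ∑ k : Fin N,
        ‖(divB (torusT P i) (fun κ z => unitsField (toUField W) ⟨z, κ⟩) (fun κ z => B ⟨z, κ⟩) x) j k‖ ^ 2) = 0 := by
  refine Finset.sum_eq_zero fun x _ => ?_
  rw [hBc x]
  simp

/-! ## §2 ★ The Hodge Pythagoras for a co-closed split -/

/-- ★ **`Σ_b‖B b‖² ≤ N·Σ_b‖D b‖²` FOR EVERY CO-CLOSED COVARIANT HODGE SPLIT** `D = B + D_Wφ₀`, `D*_WB = 0`: in the Hilbert–Schmidt geometry `|D|² = |B|² + |D_Wφ₀|²` (the cross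
term is `Σ_x tr(φ₀(x)ᴴ·(D*_WB)(x)) = 0`, ✓ `sum_trace_conjTranspose_covD_mul`), and op ≤ HS ≤ N·op. [cite: Balaban1984PropagatorsI, (1.21) p.21; Balaban1985BackgroundPropagators, (3.8) p.392] -/
theorem sum_norm_sq_le_of_coclosed_split (W : GaugeField P i (Matrix.specialUnitaryGroup (Fin N) ℂ))
    (D B : PBond P i → Matrix (Fin N) (Fin N) ℂ) (φ₀ : Site P i → Matrix (Fin N) (Fin N) ℂ)
    (hsplit : ∀ b : PBond P i, D b = B b + covD (torusT P i) (fun κ z => unitsField (toUField W) ⟨z, κ⟩) b.dir φ₀ b.src)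
    (hBc : ∀ x : Site P i, divB (torusT P i) (fun κ z => unitsField (toUField W) ⟨z, κ⟩) (fun κ z => B ⟨z, κ⟩) x = 0) :
    ∑ b : PBond P i, ‖B b‖ ^ 2 ≤ N * ∑ b : PBond P i, ‖D b‖ ^ 2 := by
  have hVu : ∀ (ν : Fin P.d) (x : Site P i),
      ((fun κ z => unitsField (toUField W) ⟨z, κ⟩) ν x : Matrix (Fin N) (Fin N) ℂ) ∈ unitary (Matrix (Fin N) (Fin N) ℂ) :=
    fun ν x => B7Prop2Explicit.mem_unitaryUnits.mp (unitsField_mem_unitaryUnits (toUField W) _)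
  -- the HS cross term vanishes
  have hcross : ∑ b : PBond P i, (((covD (torusT P i) (fun κ z => unitsField (toUField W) ⟨z, κ⟩) b.dir φ₀ b.src)ᴴ * B b).trace).re = 0 := by
    have h := sum_trace_conjTranspose_covD_mul (P := P) (i := i) (N := N) (U := fun κ z => unitsField (toUField W) ⟨z, κ⟩) hVu φ₀ (fun κ z => B ⟨z, κ⟩)
    have h0 : ∑ x : Site P i, ((φ₀ x)ᴴ * divB (torusT P i) (fun κ z => unitsField (toUField W) ⟨z, κ⟩) (fun κ z => B ⟨z, κ⟩) x).trace = 0 :=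
      Finset.sum_eq_zero fun x _ => by rw [hBc x, Matrix.mul_zero, Matrix.trace_zero]
    rw [h0] at h
    rw [← Complex.re_sum, B10StarCount.sum_pbond]
    show (∑ x : Site P i, ∑ μ : Fin P.d, ((covD (torusT P i) (fun κ z => unitsField (toUField W) ⟨z, κ⟩) μ φ₀ x)ᴴ * B ⟨x, μ⟩).trace).re = 0
    rw [h, Complex.zero_re]
  -- HS Pythagoras, bond by bond summed
  have hHS : ∑ b : PBond P i, ∑ a : Fin N, ∑ c : Fin N, Complex.normSq (D b a c)
      = ∑ b : PBond P i, ∑ a : Fin N, ∑ c : Fin N, Complex.normSq (B b a c)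
        + ∑ b : PBond P i, ∑ a : Fin N, ∑ c : Fin N, Complex.normSq ((covD (torusT P i) (fun κ z => unitsField (toUField W) ⟨z, κ⟩) b.dir φ₀ b.src) a c) := by
    have e : ∀ b : PBond P i, ∑ a : Fin N, ∑ c : Fin N, Complex.normSq (D b a c)
        = ∑ a : Fin N, ∑ c : Fin N, Complex.normSq (B b a c)
          + ∑ a : Fin N, ∑ c : Fin N, Complex.normSq ((covD (torusT P i) (fun κ z => unitsField (toUField W) ⟨z, κ⟩) b.dir φ₀ b.src) a c)
          + 2 * (((covD (torusT P i) (fun κ z => unitsField (toUField W) ⟨z, κ⟩) b.dir φ₀ b.src)ᴴ * B b).trace).re := by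
      intro b
      rw [show D b = B b + covD (torusT P i) (fun κ z => unitsField (toUField W) ⟨z, κ⟩) b.dir φ₀ b.src from hsplit b]
      exact sum_normSq_add_eq _ _
    simp only [e, Finset.sum_add_distrib, ← Finset.mul_sum, hcross, mul_zero, add_zero]
  have hpos : 0 ≤ ∑ b : PBond P i, ∑ a : Fin N, ∑ c : Fin N,
      Complex.normSq ((covD (torusT P i) (fun κ z => unitsField (toUField W) ⟨z, κ⟩) b.dir φ₀ b.src) a c) :=
    Finset.sum_nonneg fun _ _ => Finset.sum_nonneg fun _ _ => Finset.sum_nonneg fun _ _ => Complex.normSq_nonneg _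
  -- op ≤ HS on the left, HS ≤ N·op on the right
  have hnsq : ∀ X : Matrix (Fin N) (Fin N) ℂ, ∑ a : Fin N, ∑ c : Fin N, Complex.normSq (X a c) = ∑ a : Fin N, ∑ c : Fin N, ‖X a c‖ ^ 2 :=
    fun X => Finset.sum_congr rfl fun a _ => Finset.sum_congr rfl fun c _ => Complex.normSq_eq_norm_sq _
  calc ∑ b : PBond P i, ‖B b‖ ^ 2
      ≤ ∑ b : PBond P i, ∑ a : Fin N, ∑ c : Fin N, Complex.normSq (B b a c) := by
        refine Finset.sum_le_sum fun b _ => ?_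
        rw [hnsq]
        exact MatrixNorms.opNorm_sq_le_sum_norm_sq _
    _ ≤ ∑ b : PBond P i, ∑ a : Fin N, ∑ c : Fin N, Complex.normSq (D b a c) := by rw [hHS]; linarith
    _ ≤ N * ∑ b : PBond P i, ‖D b‖ ^ 2 := by
        rw [Finset.mul_sum]
        refine Finset.sum_le_sum fun b _ => ?_
        rw [hnsq]
        exact sum_norm_sq_le_mul_opNorm_sq _

/-! ## §3 ★★ The generic row (B) from hKg-K -/

variable [NeZero N]

/-- ★★ **ROW (B) FROM hKg-K, GENERIC**: `SU(N)` background with `dist1(W(∂p)) ≤ a`, `0 ≤ a`; a co-closed covariant Hodge split `D = B + D_Wφ₀` (`D*_WB = 0`); the displayed row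
hKg-K in the form `K_W(D_Wφ₀) ≤ C_g·K_W(D) + Θ`.  Then `G_W(B) + CURL_HS(B) ≤ 8N(1 + C_g)·K_W(D) + 8N·Θ + N²·d·a·(64a + 2)·Σ_b‖D b‖²`.
[cite: Balaban1985Variational, (135) p.298, (141)-(143) p.299; Balaban1985BackgroundPropagators, (3.4) p.391, (3.8)-(3.10) p.392] -/
theorem coclosed_energies_le_of_hKgK (W : GaugeField P i (Matrix.specialUnitaryGroup (Fin N) ℂ)) {a C_g Θ : ℝ} (ha : 0 ≤ a)
    (hW : ∀ p : Plaq P i, dist1 (GaugeField.plaqHol W p) ≤ a)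
    (D B : PBond P i → Matrix (Fin N) (Fin N) ℂ) (φ₀ : Site P i → Matrix (Fin N) (Fin N) ℂ)
    (hsplit : ∀ b : PBond P i, D b = B b + covD (torusT P i) (fun κ z => unitsField (toUField W) ⟨z, κ⟩) b.dir φ₀ b.src)
    (hBc : ∀ x : Site P i, divB (torusT P i) (fun κ z => unitsField (toUField W) ⟨z, κ⟩) (fun κ z => B ⟨z, κ⟩) x = 0)
    (Dφ : PBond P i → Matrix (Fin N) (Fin N) ℂ)
    (hDφ : ∀ b : PBond P i, Dφ b = covD (torusT P i) (fun κ z => unitsField (toUField W) ⟨z, κ⟩) b.dir φ₀ b.src)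
    (hKg : (∑ p : Plaq P i, ‖((Complex.I • Dφ ⟨p.src, p.μ⟩)
          + ((W ⟨p.src, p.μ⟩ : Matrix (Fin N) (Fin N) ℂ) * (Complex.I • Dφ ⟨p.src.shift p.μ, p.ν⟩) * star (W ⟨p.src, p.μ⟩ : Matrix (Fin N) (Fin N) ℂ))
          - (((W ⟨p.src, p.μ⟩ * W ⟨p.src.shift p.μ, p.ν⟩ * (W ⟨p.src.shift p.ν, p.μ⟩)⁻¹ : Matrix.specialUnitaryGroup (Fin N) ℂ) : Matrix (Fin N) (Fin N) ℂ)
              * (Complex.I • Dφ ⟨p.src.shift p.ν, p.μ⟩)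
              * star ((W ⟨p.src, p.μ⟩ * W ⟨p.src.shift p.μ, p.ν⟩ * (W ⟨p.src.shift p.ν, p.μ⟩)⁻¹ : Matrix.specialUnitaryGroup (Fin N) ℂ) : Matrix (Fin N) (Fin N) ℂ))
          - (((GaugeField.plaqHol W p : Matrix.specialUnitaryGroup (Fin N) ℂ) : Matrix (Fin N) (Fin N) ℂ) * (Complex.I • Dφ ⟨p.src, p.ν⟩)
              * star ((GaugeField.plaqHol W p : Matrix.specialUnitaryGroup (Fin N) ℂ) : Matrix (Fin N) (Fin N) ℂ)))‖ ^ 2)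
      ≤ C_g * (∑ p : Plaq P i, ‖((Complex.I • D ⟨p.src, p.μ⟩)
          + ((W ⟨p.src, p.μ⟩ : Matrix (Fin N) (Fin N) ℂ) * (Complex.I • D ⟨p.src.shift p.μ, p.ν⟩) * star (W ⟨p.src, p.μ⟩ : Matrix (Fin N) (Fin N) ℂ))
          - (((W ⟨p.src, p.μ⟩ * W ⟨p.src.shift p.μ, p.ν⟩ * (W ⟨p.src.shift p.ν, p.μ⟩)⁻¹ : Matrix.specialUnitaryGroup (Fin N) ℂ) : Matrix (Fin N) (Fin N) ℂ)
              * (Complex.I • D ⟨p.src.shift p.ν, p.μ⟩)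
              * star ((W ⟨p.src, p.μ⟩ * W ⟨p.src.shift p.μ, p.ν⟩ * (W ⟨p.src.shift p.ν, p.μ⟩)⁻¹ : Matrix.specialUnitaryGroup (Fin N) ℂ) : Matrix (Fin N) (Fin N) ℂ))
          - (((GaugeField.plaqHol W p : Matrix.specialUnitaryGroup (Fin N) ℂ) : Matrix (Fin N) (Fin N) ℂ) * (Complex.I • D ⟨p.src, p.ν⟩)
              * star ((GaugeField.plaqHol W p : Matrix.specialUnitaryGroup (Fin N) ℂ) : Matrix (Fin N) (Fin N) ℂ)))‖ ^ 2) + Θ) :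
    (∑ b : PBond P i, ∑ ν : Fin P.d,
        ‖((W ⟨b.src, ν⟩ : Matrix.specialUnitaryGroup (Fin N) ℂ) : Matrix (Fin N) (Fin N) ℂ) * B ⟨b.src.shift ν, b.dir⟩
            * star ((W ⟨b.src, ν⟩ : Matrix.specialUnitaryGroup (Fin N) ℂ) : Matrix (Fin N) (Fin N) ℂ) - B b‖ ^ 2)
      + (∑ x : Site P i, ∑ μ : Fin P.d, ∑ ν : Fin P.d,
        (if μ < ν then ∑ j : Fin N, ∑ k : Fin N,
          ‖(curl (torusT P i) (fun κ z => unitsField (toUField W) ⟨z, κ⟩) (fun κ z => B ⟨z, κ⟩) μ ν x) j k‖ ^ 2 else 0))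
      ≤ 8 * N * (1 + C_g) * (∑ p : Plaq P i, ‖((Complex.I • D ⟨p.src, p.μ⟩)
          + ((W ⟨p.src, p.μ⟩ : Matrix (Fin N) (Fin N) ℂ) * (Complex.I • D ⟨p.src.shift p.μ, p.ν⟩) * star (W ⟨p.src, p.μ⟩ : Matrix (Fin N) (Fin N) ℂ))
          - (((W ⟨p.src, p.μ⟩ * W ⟨p.src.shift p.μ, p.ν⟩ * (W ⟨p.src.shift p.ν, p.μ⟩)⁻¹ : Matrix.specialUnitaryGroup (Fin N) ℂ) : Matrix (Fin N) (Fin N) ℂ)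
              * (Complex.I • D ⟨p.src.shift p.ν, p.μ⟩)
              * star ((W ⟨p.src, p.μ⟩ * W ⟨p.src.shift p.μ, p.ν⟩ * (W ⟨p.src.shift p.ν, p.μ⟩)⁻¹ : Matrix.specialUnitaryGroup (Fin N) ℂ) : Matrix (Fin N) (Fin N) ℂ))
          - (((GaugeField.plaqHol W p : Matrix.specialUnitaryGroup (Fin N) ℂ) : Matrix (Fin N) (Fin N) ℂ) * (Complex.I • D ⟨p.src, p.ν⟩)
              * star ((GaugeField.plaqHol W p : Matrix.specialUnitaryGroup (Fin N) ℂ) : Matrix (Fin N) (Fin N) ℂ)))‖ ^ 2)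
        + 8 * N * Θ + (N : ℝ) ^ 2 * P.d * a * (64 * a + 2) * ∑ b : PBond P i, ‖D b‖ ^ 2 := by
  -- the four-term energies of `B`, `D`, `Dφ` and the bond masses, as letters
  set KB := (∑ p : Plaq P i, ‖((Complex.I • B ⟨p.src, p.μ⟩)
          + ((W ⟨p.src, p.μ⟩ : Matrix (Fin N) (Fin N) ℂ) * (Complex.I • B ⟨p.src.shift p.μ, p.ν⟩) * star (W ⟨p.src, p.μ⟩ : Matrix (Fin N) (Fin N) ℂ))
          - (((W ⟨p.src, p.μ⟩ * W ⟨p.src.shift p.μ, p.ν⟩ * (W ⟨p.src.shift p.ν, p.μ⟩)⁻¹ : Matrix.specialUnitaryGroup (Fin N) ℂ) : Matrix (Fin N) (Fin N) ℂ)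
              * (Complex.I • B ⟨p.src.shift p.ν, p.μ⟩)
              * star ((W ⟨p.src, p.μ⟩ * W ⟨p.src.shift p.μ, p.ν⟩ * (W ⟨p.src.shift p.ν, p.μ⟩)⁻¹ : Matrix.specialUnitaryGroup (Fin N) ℂ) : Matrix (Fin N) (Fin N) ℂ))
          - (((GaugeField.plaqHol W p : Matrix.specialUnitaryGroup (Fin N) ℂ) : Matrix (Fin N) (Fin N) ℂ) * (Complex.I • B ⟨p.src, p.ν⟩)
              * star ((GaugeField.plaqHol W p : Matrix.specialUnitaryGroup (Fin N) ℂ) : Matrix (Fin N) (Fin N) ℂ)))‖ ^ 2) with hKB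
  set MB := ∑ b : PBond P i, ‖B b‖ ^ 2 with hMBdef
  set MD := ∑ b : PBond P i, ‖D b‖ ^ 2 with hMDdef
  have hN : (0 : ℝ) ≤ N := Nat.cast_nonneg N
  have hd : (0 : ℝ) ≤ P.d := Nat.cast_nonneg P.d
  have hMB0 : 0 ≤ MB := Finset.sum_nonneg fun _ _ => sq_nonneg _
  -- (1) Weitzenböck + (2) co-closedness
  have h1 := sum_normSq_covGrad_le_curl_divB W ha hW B
  rw [sum_divHS_eq_zero_of_coclosed W B hBc, add_zero] at h1
  -- (3) curl against the plaquette energy of `B`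
  have h3 := curlHS_le_plaqK W hW B
  rw [curlHS_I_smul_eq] at h3
  -- (4) parallelogram `K_W(B) ≤ 2K_W(D) + 2K_W(Dφ)` and (5) hKg-K
  have hB' : ∀ b : PBond P i, B b = D b - Dφ b := fun b => by rw [hsplit b, hDφ b, add_sub_cancel_right]
  have h4 := plaqK_sub_le W B D Dφ hB'
  -- (6) Pythagoras
  have h6 : MB ≤ N * MD := sum_norm_sq_le_of_coclosed_split W D B φ₀ hsplit hBc
  -- products for the linear bookkeeping
  have h3' := mul_le_mul_of_nonneg_left h4 (by positivity : (0 : ℝ) ≤ N * 2)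
  have h5' := mul_le_mul_of_nonneg_left hKg (by positivity : (0 : ℝ) ≤ N * 4)
  have h6a := mul_le_mul_of_nonneg_left h6 (by positivity : (0 : ℝ) ≤ N * (32 * P.d * a ^ 2))
  have h6b := mul_le_mul_of_nonneg_left h6 (by positivity : (0 : ℝ) ≤ 2 * P.d * a * N)
  nlinarith [h1, h3, h3', h5', h6a, h6b, hMB0, hN, hd, ha]

/-! ## §4 ★★★ The T³ reading: row (B) of the R5 door from hKg-K -/

section T3

open Literature.MathematicalPhysics.QuantumFieldTheory.Balaban1983to89.T3ContinuumYM3Torus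
open Literature.MathematicalPhysics.QuantumFieldTheory.Balaban1983to89.T3PrintedRegularMinimiser
open Literature.MathematicalPhysics.QuantumFieldTheory.Balaban1983to89.T3RegularMinimiser (regThreshold)

/-- The plaquette clause of print's (6)(e): `W ∈ regFibrePr … e V ⇒ dist1(W(∂p)) ≤ e·(L^{K−n})⁻²` at every plaquette. [cite: Balaban1985Variational, (2) p.278, (6) p.278] -/
theorem dist1_plaqHol_le_of_mem_regFibrePr (F : T3Family) {n K : ℕ} (h : n ≤ K) {e : ℝ}
    {V : GaugeField (F.P n) 0 (Matrix.specialUnitaryGroup (Fin 2) ℂ)} {W : GaugeField (F.P K) 0 (Matrix.specialUnitaryGroup (Fin 2) ℂ)}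
    (hW : W ∈ regFibrePr F n K h e V) (p : Plaq (F.P K) 0) :
    dist1 (GaugeField.plaqHol W p) ≤ e * (((F.L : ℝ) ^ (K - n)) ^ 2)⁻¹ := by
  have hpl := (((mem_regFibrePr_iff F).mp hW).2).plaqSmall p
  rw [regThreshold] at hpl
  have e1 : ((F.L : ℝ)⁻¹) ^ (2 * (K - n)) = (((F.L : ℝ) ^ (K - n)) ^ 2)⁻¹ := by
    rw [inv_pow, ← pow_mul, mul_comm]
  rw [e1] at hpl
  exact hpl.le

/-- ★★★ **ROW (B) OF THE R5 DOOR FROM hKg-K** (`N = 2`, `d = 3`).  Member of a T³ family, background `W` with the plaquette clause `dist1(W(∂p)) ≤ e·ℓ⁻²`, `ℓ = L^{K−n}`, `0 ≤ e ≤ 1`;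
a co-closed covariant Hodge split `D = B + D_Wφ₀`; hKg-K DISPLAYED: `K_W(D_Wφ₀) ≤ C_g·K_W(D) + θ_g·e·ℓ⁻²·M(D)` (at the door: at `IsCritR2 W`, (N2)).  Then row (B) of
✓ `Prop7ZetaRowOfEngineRows.zetaRow_of_engineRows` holds VERBATIM with `ζ_B := 16·(1 + C_g)` and `θ_B := 16·θ_g + 792`:
`G_W(B) + CURL_HS(B) ≤ ζ_B·K_W(D) + θ_B·e·ℓ⁻²·M(D)`. [cite: Balaban1985Variational, (6) p.278, (135) p.298, (141)-(143) p.299; Balaban1985BackgroundPropagators, (3.4) p.391, (3.8)-(3.10) p.392, Thm 3.11 p.416] -/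
theorem rowB_of_hKgK_T3 (F : T3Family) (K n : ℕ) (W : GaugeField (F.P K) 0 (Matrix.specialUnitaryGroup (Fin 2) ℂ)) {e C_g θ_g : ℝ}
    (he0 : 0 ≤ e) (he1 : e ≤ 1)
    (hW : ∀ p : Plaq (F.P K) 0, dist1 (GaugeField.plaqHol W p) ≤ e * (((F.L : ℝ) ^ (K - n)) ^ 2)⁻¹)
    (D B : PBond (F.P K) 0 → Matrix (Fin 2) (Fin 2) ℂ) (φ₀ : Site (F.P K) 0 → Matrix (Fin 2) (Fin 2) ℂ)
    (hsplit : ∀ b : PBond (F.P K) 0, D b = B b + covD (torusT (F.P K) 0) (fun κ z => unitsField (toUField W) ⟨z, κ⟩) b.dir φ₀ b.src)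
    (hBc : ∀ x : Site (F.P K) 0, divB (torusT (F.P K) 0) (fun κ z => unitsField (toUField W) ⟨z, κ⟩) (fun κ z => B ⟨z, κ⟩) x = 0)
    (Dφ : PBond (F.P K) 0 → Matrix (Fin 2) (Fin 2) ℂ)
    (hDφ : ∀ b : PBond (F.P K) 0, Dφ b = covD (torusT (F.P K) 0) (fun κ z => unitsField (toUField W) ⟨z, κ⟩) b.dir φ₀ b.src)
    (hKg : (∑ p : Plaq (F.P K) 0, ‖((Complex.I • Dφ ⟨p.src, p.μ⟩) + ((W ⟨p.src, p.μ⟩ : Matrix (Fin 2) (Fin 2) ℂ) * (Complex.I • Dφ ⟨p.src.shift p.μ, p.ν⟩) * star (W ⟨p.src, p.μ⟩ : Matrix (Fin 2) (Fin 2) ℂ))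
            - (((W ⟨p.src, p.μ⟩ * W ⟨p.src.shift p.μ, p.ν⟩ * (W ⟨p.src.shift p.ν, p.μ⟩)⁻¹ : Matrix.specialUnitaryGroup (Fin 2) ℂ) : Matrix (Fin 2) (Fin 2) ℂ) * (Complex.I • Dφ ⟨p.src.shift p.ν, p.μ⟩) * star ((W ⟨p.src, p.μ⟩ * W ⟨p.src.shift p.μ, p.ν⟩ * (W ⟨p.src.shift p.ν, p.μ⟩)⁻¹ : Matrix.specialUnitaryGroup (Fin 2) ℂ) : Matrix (Fin 2) (Fin 2) ℂ))
            - (((GaugeField.plaqHol W p : Matrix.specialUnitaryGroup (Fin 2) ℂ) : Matrix (Fin 2) (Fin 2) ℂ) * (Complex.I • Dφ ⟨p.src, p.ν⟩) * star ((GaugeField.plaqHol W p : Matrix.specialUnitaryGroup (Fin 2) ℂ) : Matrix (Fin 2) (Fin 2) ℂ)))‖ ^ 2)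
      ≤ C_g * (∑ p : Plaq (F.P K) 0, ‖((Complex.I • D ⟨p.src, p.μ⟩) + ((W ⟨p.src, p.μ⟩ : Matrix (Fin 2) (Fin 2) ℂ) * (Complex.I • D ⟨p.src.shift p.μ, p.ν⟩) * star (W ⟨p.src, p.μ⟩ : Matrix (Fin 2) (Fin 2) ℂ))
            - (((W ⟨p.src, p.μ⟩ * W ⟨p.src.shift p.μ, p.ν⟩ * (W ⟨p.src.shift p.ν, p.μ⟩)⁻¹ : Matrix.specialUnitaryGroup (Fin 2) ℂ) : Matrix (Fin 2) (Fin 2) ℂ) * (Complex.I • D ⟨p.src.shift p.ν, p.μ⟩) * star ((W ⟨p.src, p.μ⟩ * W ⟨p.src.shift p.μ, p.ν⟩ * (W ⟨p.src.shift p.ν, p.μ⟩)⁻¹ : Matrix.specialUnitaryGroup (Fin 2) ℂ) : Matrix (Fin 2) (Fin 2) ℂ))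
            - (((GaugeField.plaqHol W p : Matrix.specialUnitaryGroup (Fin 2) ℂ) : Matrix (Fin 2) (Fin 2) ℂ) * (Complex.I • D ⟨p.src, p.ν⟩) * star ((GaugeField.plaqHol W p : Matrix.specialUnitaryGroup (Fin 2) ℂ) : Matrix (Fin 2) (Fin 2) ℂ)))‖ ^ 2)
        + θ_g * e * (((F.L : ℝ) ^ (K - n)) ^ 2)⁻¹ * (∑ b : PBond (F.P K) 0, ‖D b‖ ^ 2)) :
    (∑ b : PBond (F.P K) 0, ∑ ν : Fin (F.P K).d,
        ‖((W ⟨b.src, ν⟩ : Matrix.specialUnitaryGroup (Fin 2) ℂ) : Matrix (Fin 2) (Fin 2) ℂ) * B ⟨b.src.shift ν, b.dir⟩ * star ((W ⟨b.src, ν⟩ : Matrix.specialUnitaryGroup (Fin 2) ℂ) : Matrix (Fin 2) (Fin 2) ℂ) - B b‖ ^ 2)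
        + (∑ x : Site (F.P K) 0, ∑ μ : Fin (F.P K).d, ∑ ν : Fin (F.P K).d,
        (if μ < ν then ∑ j : Fin 2, ∑ k : Fin 2, ‖(curl (torusT (F.P K) 0) (fun κ z => unitsField (toUField W) ⟨z, κ⟩) (fun κ z => B ⟨z, κ⟩) μ ν x) j k‖ ^ 2 else 0))
      ≤ (16 * (1 + C_g)) * (∑ p : Plaq (F.P K) 0, ‖((Complex.I • D ⟨p.src, p.μ⟩) + ((W ⟨p.src, p.μ⟩ : Matrix (Fin 2) (Fin 2) ℂ) * (Complex.I • D ⟨p.src.shift p.μ, p.ν⟩) * star (W ⟨p.src, p.μ⟩ : Matrix (Fin 2) (Fin 2) ℂ))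
            - (((W ⟨p.src, p.μ⟩ * W ⟨p.src.shift p.μ, p.ν⟩ * (W ⟨p.src.shift p.ν, p.μ⟩)⁻¹ : Matrix.specialUnitaryGroup (Fin 2) ℂ) : Matrix (Fin 2) (Fin 2) ℂ) * (Complex.I • D ⟨p.src.shift p.ν, p.μ⟩) * star ((W ⟨p.src, p.μ⟩ * W ⟨p.src.shift p.μ, p.ν⟩ * (W ⟨p.src.shift p.ν, p.μ⟩)⁻¹ : Matrix.specialUnitaryGroup (Fin 2) ℂ) : Matrix (Fin 2) (Fin 2) ℂ))
            - (((GaugeField.plaqHol W p : Matrix.specialUnitaryGroup (Fin 2) ℂ) : Matrix (Fin 2) (Fin 2) ℂ) * (Complex.I • D ⟨p.src, p.ν⟩) * star ((GaugeField.plaqHol W p : Matrix.specialUnitaryGroup (Fin 2) ℂ) : Matrix (Fin 2) (Fin 2) ℂ)))‖ ^ 2)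
        + (16 * θ_g + 792) * e * (((F.L : ℝ) ^ (K - n)) ^ 2)⁻¹ * (∑ b : PBond (F.P K) 0, ‖D b‖ ^ 2) := by
  have hL1 : (1 : ℝ) ≤ F.L := by exact_mod_cast F.hL.2.le
  have hℓ2 : 0 < (((F.L : ℝ) ^ (K - n)) ^ 2)⁻¹ := by
    have hL : (0 : ℝ) < F.L := by linarith
    positivity
  have hℓ1 : (((F.L : ℝ) ^ (K - n)) ^ 2)⁻¹ ≤ 1 := by
    have : (1 : ℝ) ≤ ((F.L : ℝ) ^ (K - n)) ^ 2 := one_le_pow₀ (one_le_pow₀ hL1)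
    exact inv_le_one_of_one_le₀ this
  have ha : 0 ≤ e * (((F.L : ℝ) ^ (K - n)) ^ 2)⁻¹ := mul_nonneg he0 hℓ2.le
  have ha1 : e * (((F.L : ℝ) ^ (K - n)) ^ 2)⁻¹ ≤ 1 := by nlinarith
  have h := coclosed_energies_le_of_hKgK (P := F.P K) (i := 0) (N := 2) W ha hW D B φ₀ hsplit hBc Dφ hDφ hKg
  have hM0 : 0 ≤ ∑ b : PBond (F.P K) 0, ‖D b‖ ^ 2 := Finset.sum_nonneg fun _ _ => sq_nonneg _
  have hd : ((F.P K).d : ℝ) = 3 := by simp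
  rw [hd] at h
  -- `N² d a (64a+2) ≤ 4·3·66·a` since `a ≤ 1`
  have hjunk : (2 : ℝ) ^ 2 * 3 * (e * (((F.L : ℝ) ^ (K - n)) ^ 2)⁻¹) * (64 * (e * (((F.L : ℝ) ^ (K - n)) ^ 2)⁻¹) + 2) * (∑ b : PBond (F.P K) 0, ‖D b‖ ^ 2)
      ≤ 792 * e * (((F.L : ℝ) ^ (K - n)) ^ 2)⁻¹ * (∑ b : PBond (F.P K) 0, ‖D b‖ ^ 2) := by
    have h66 : 64 * (e * (((F.L : ℝ) ^ (K - n)) ^ 2)⁻¹) + 2 ≤ 66 := by linarith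
    have := mul_le_mul_of_nonneg_left h66 (by positivity : (0 : ℝ) ≤ (2 : ℝ) ^ 2 * 3 * (e * (((F.L : ℝ) ^ (K - n)) ^ 2)⁻¹) * (∑ b : PBond (F.P K) 0, ‖D b‖ ^ 2))
    nlinarith [hM0, ha]
  simp only [Nat.cast_ofNat] at h
  -- name the four energies so that the bookkeeping is linear in them
  set KD := (∑ p : Plaq (F.P K) 0, ‖((Complex.I • D ⟨p.src, p.μ⟩) + ((W ⟨p.src, p.μ⟩ : Matrix (Fin 2) (Fin 2) ℂ) * (Complex.I • D ⟨p.src.shift p.μ, p.ν⟩) * star (W ⟨p.src, p.μ⟩ : Matrix (Fin 2) (Fin 2) ℂ))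
            - (((W ⟨p.src, p.μ⟩ * W ⟨p.src.shift p.μ, p.ν⟩ * (W ⟨p.src.shift p.ν, p.μ⟩)⁻¹ : Matrix.specialUnitaryGroup (Fin 2) ℂ) : Matrix (Fin 2) (Fin 2) ℂ) * (Complex.I • D ⟨p.src.shift p.ν, p.μ⟩) * star ((W ⟨p.src, p.μ⟩ * W ⟨p.src.shift p.μ, p.ν⟩ * (W ⟨p.src.shift p.ν, p.μ⟩)⁻¹ : Matrix.specialUnitaryGroup (Fin 2) ℂ) : Matrix (Fin 2) (Fin 2) ℂ))
            - (((GaugeField.plaqHol W p : Matrix.specialUnitaryGroup (Fin 2) ℂ) : Matrix (Fin 2) (Fin 2) ℂ) * (Complex.I • D ⟨p.src, p.ν⟩) * star ((GaugeField.plaqHol W p : Matrix.specialUnitaryGroup (Fin 2) ℂ) : Matrix (Fin 2) (Fin 2) ℂ)))‖ ^ 2) with hKD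
  set MD := (∑ b : PBond (F.P K) 0, ‖D b‖ ^ 2) with hMD
  set ℓi := (((F.L : ℝ) ^ (K - n)) ^ 2)⁻¹ with hℓi
  nlinarith [h, hjunk, hM0, ha, he0, hℓ2]

end T3

end Summit.QuantumFields.YangMills.Theorems.Prop7CoclosedEnergiesOfHKgK

end
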